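import Summits.Ventures.CertifiedArithmetic.LowPrec.DoubleRoundingSlipWide
import Mathlib.Analysis.Real.Sqrt
import Mathlib.Data.Nat.Sqrt

/-!
# Correctly rounded square roots on the format records (the surrogate `roundNESqrt`, `DRSqrt`)

HONEST FRAMING: certified error envelopes and provably optimal rounding/accumulation schemes for
low-precision formats under stated cost models; every table by two implementations; no hardware
or vendor claims.

`fl_φ (√c)` for a rational `c ≥ 0` under the saturating round-to-nearest-even `roundNE` of this
packet (subnormals kept). The root is irrational in general; this file computes its correct
rounding WITHOUT real arithmetic. With `ν = quantum_φ / 2` and `h = ⌊√c / ν⌋ = Nat.sqrt ⌊c / ν²⌋`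
(`sqrtCell`), the SURROGATE `sqrtSurr φ c` is `h ν` if `(h ν)² = c` and the cell midpoint
`(h + ½) ν` otherwise, and `roundNESqrt φ c := roundNE φ (sqrtSurr φ c)`. Every value of `φ` and
every midpoint of two values is a multiple of `ν`, so no tie and no value lies in an open cell
`(k ν, (k+1) ν)`: `roundNE φ` is constant on it (`toRat_roundNE_eq_of_sameCell`) and a real number
in it has the same, unique, nearest value (`abs_sub_lt_of_sameCell`). Hence `roundNESqrt φ c` is a
nearest value of `φ` to `Real.sqrt c` (`roundNESqrt_nearest`), THE nearest one unless `c` is the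
square of a multiple of `ν`, in which case the surrogate is the root itself and `roundNE` breaks a
tie to even (`roundNESqrt_spec`). Everything reduces in the kernel (`decide +kernel`; §6).

TRANSFER (`toRat_roundNE_sqrtSurr`): if `quantum_ψ ∣ quantum_φ` (`qexp ψ ≤ qexp φ`), the
`ψ`-surrogate of `√c` is also a `φ`-surrogate: `fl_φ (sqrtSurr ψ c) = fl_φ (√c)`. So the double
rounding property `DRSqrt φ ψ` (§5: `fl_φ (fl_ψ (√a)) = fl_φ (√a)` for every value `a ≥ 0` of `φ`,
ONE square root executed in `ψ` and converted to `φ`) is a statement about one rational per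
operand, declared here with its source-exhaustion boolean `drSqrtExh`; its parameter test and
the tables of the named matrix are `DoubleRoundingSqrtTables.lean`, the clause for every pair of
records is `DoubleRoundingSqrt.lean`, the `13 × 13` decision `DoubleRoundingSqrtMatrix.lean`
(implementation A: `code/enum/doublesqrt_decision.py`). PLACEMENT: innocuous double rounding of
square roots for `p₂ ≥ 2 p₁ + 2` is [Figueroa1995]; [Roux2014, Thm 25, Rem 26, Table II]
formalises it in Coq/Flocq with gradual underflow. No hardware or vendor claims.
-/

namespace Summit.Ventures.CertifiedArithmetic

open Literature.ComputerArithmetic.FloatingPoint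
open Literature.ComputerArithmetic.FloatingPoint.Format
open Literature.ComputerArithmetic.FloatingPoint.MiniFloat

/-! ## §1 The surrogate of a square root -/

/-- The half-quantum cell of `√c`: `⌊√c / ν⌋ = Nat.sqrt ⌊c / ν²⌋`, `ν = quantum φ / 2` (`0` for
`c < 0`). [this packet] -/
def sqrtCell (φ : Format) (c : ℚ) : ℕ := Nat.sqrt ⌊c / (φ.quantum / 2) ^ 2⌋.toNat

/-- The square-root surrogate: the root itself if it is the multiple `h ν` of the half quantum,
else the midpoint `(h + ½) ν` of its open cell. [this packet] -/
def sqrtSurr (φ : Format) (c : ℚ) : ℚ :=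
  if ((sqrtCell φ c : ℚ) * (φ.quantum / 2)) ^ 2 = c then (sqrtCell φ c : ℚ) * (φ.quantum / 2)
  else ((sqrtCell φ c : ℚ) + 1 / 2) * (φ.quantum / 2)

/-- The correctly rounded square root of a rational `c ≥ 0` in `φ` (saturating RNE), computed on
the surrogate; certified against `Real.sqrt` in §3. [this packet; cite: IEEE7542019, §5.4.1] -/
def roundNESqrt (φ : Format) (c : ℚ) : MiniFloat φ := roundNE φ (sqrtSurr φ c)

variable {φ : Format}

/-- `(h ν)² ≤ c` for `c ≥ 0`. [folklore] -/
theorem sqrtCell_sq_le {c : ℚ} (hc : 0 ≤ c) : ((sqrtCell φ c : ℚ) * (φ.quantum / 2)) ^ 2 ≤ c := by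
  have hν : 0 < φ.quantum / 2 := by have := φ.quantum_pos; positivity
  have h1 : ((sqrtCell φ c ^ 2 : ℕ) : ℚ) ≤ c / (φ.quantum / 2) ^ 2 :=
    natCast_le_of_le_floor_toNat (by positivity) (Nat.sqrt_le' _)
  push_cast at h1
  rw [mul_pow]; exact (le_div_iff₀ (by positivity)).mp h1

/-- `c < ((h+1) ν)²`. [folklore] -/
theorem lt_sqrtCell_succ_sq (c : ℚ) : c < (((sqrtCell φ c : ℚ) + 1) * (φ.quantum / 2)) ^ 2 := by
  have hν : 0 < φ.quantum / 2 := by have := φ.quantum_pos; positivity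
  have h1 : c / (φ.quantum / 2) ^ 2 < ((sqrtCell φ c + 1) ^ 2 : ℕ) :=
    lt_natCast_of_floor_toNat_lt (Nat.lt_succ_sqrt' _)
  push_cast at h1
  rw [mul_pow]; exact (div_lt_iff₀ (by positivity)).mp h1

/-- A multiple `K ν` of the half quantum with `(K ν)² ≤ c` is at most `h ν`. [folklore] -/
theorem le_sqrtCell_of_sq_le {c : ℚ} {K : ℕ} (h : ((K : ℚ) * (φ.quantum / 2)) ^ 2 ≤ c) :
    K ≤ sqrtCell φ c := by
  have hν : 0 < φ.quantum / 2 := by have := φ.quantum_pos; positivity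
  have h1 : ((K ^ 2 : ℕ) : ℚ) ≤ c / (φ.quantum / 2) ^ 2 := by
    push_cast; rw [le_div_iff₀ (by positivity), ← mul_pow]; exact h
  have h2 : ((K ^ 2 : ℕ) : ℤ) ≤ ⌊c / (φ.quantum / 2) ^ 2⌋ := Int.le_floor.mpr (by exact_mod_cast h1)
  have h3 : K ^ 2 ≤ ⌊c / (φ.quantum / 2) ^ 2⌋.toNat := by
    simpa only [Int.toNat_natCast] using Int.toNat_le_toNat h2
  exact Nat.le_sqrt'.mpr h3

/-- Exact case of the surrogate. [this packet] -/
theorem sqrtSurr_of_sq_eq {c : ℚ} (h : ((sqrtCell φ c : ℚ) * (φ.quantum / 2)) ^ 2 = c) :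
    sqrtSurr φ c = (sqrtCell φ c : ℚ) * (φ.quantum / 2) := by rw [sqrtSurr, if_pos h]

/-- Inexact case of the surrogate: the cell midpoint. [this packet] -/
theorem sqrtSurr_of_sq_ne {c : ℚ} (h : ((sqrtCell φ c : ℚ) * (φ.quantum / 2)) ^ 2 ≠ c) :
    sqrtSurr φ c = ((sqrtCell φ c : ℚ) + 1 / 2) * (φ.quantum / 2) := by rw [sqrtSurr, if_neg h]

/-- `h ν ≤ sqrtSurr`. [folklore] -/
theorem sqrtCell_mul_le_sqrtSurr (c : ℚ) : (sqrtCell φ c : ℚ) * (φ.quantum / 2) ≤ sqrtSurr φ c := by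
  have hν : 0 < φ.quantum / 2 := by have := φ.quantum_pos; positivity
  by_cases h : ((sqrtCell φ c : ℚ) * (φ.quantum / 2)) ^ 2 = c
  · rw [sqrtSurr_of_sq_eq h]
  · rw [sqrtSurr_of_sq_ne h]; nlinarith

/-- `sqrtSurr < (h+1) ν`. [folklore] -/
theorem sqrtSurr_lt (c : ℚ) : sqrtSurr φ c < ((sqrtCell φ c : ℚ) + 1) * (φ.quantum / 2) := by
  have hν : 0 < φ.quantum / 2 := by have := φ.quantum_pos; positivity
  by_cases h : ((sqrtCell φ c : ℚ) * (φ.quantum / 2)) ^ 2 = c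
  · rw [sqrtSurr_of_sq_eq h]; nlinarith
  · rw [sqrtSurr_of_sq_ne h]; nlinarith

/-- The surrogate is nonnegative. [folklore] -/
theorem sqrtSurr_nonneg (c : ℚ) : 0 ≤ sqrtSurr φ c :=
  le_trans (by have := φ.quantum_pos; positivity) (sqrtCell_mul_le_sqrtSurr c)

/-- The surrogate of a positive `c` is positive. [folklore] -/
theorem sqrtSurr_pos {c : ℚ} (hc : 0 < c) : 0 < sqrtSurr φ c := by
  have hν : 0 < φ.quantum / 2 := by have := φ.quantum_pos; positivity
  by_cases h : ((sqrtCell φ c : ℚ) * (φ.quantum / 2)) ^ 2 = c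
  · rw [sqrtSurr_of_sq_eq h]
    rcases (show (0:ℚ) ≤ sqrtCell φ c * (φ.quantum / 2) by positivity).eq_or_lt with h0 | h0
    · rw [← h0] at h; simp at h; linarith
    · exact h0
  · rw [sqrtSurr_of_sq_ne h]; positivity

/-- `sqrtSurr φ 0 = 0`. [folklore] -/
theorem sqrtSurr_zero (φ : Format) : sqrtSurr φ 0 = 0 := by simp [sqrtSurr, sqrtCell]

/-! ## §2 No value and no midpoint inside an open half-quantum cell -/

/-- Closer to the smaller of `a < b` ⇒ at most their midpoint. [folklore] -/
theorem two_mul_le_add_of_abs_le {x a b : ℝ} (hab : a < b) (h : |x - a| ≤ |x - b|) :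
    2 * x ≤ a + b := by
  rcases le_or_gt x b with hxb | hxb
  · rw [abs_of_nonpos (sub_nonpos.mpr hxb)] at h
    have := (abs_le.mp h).2; linarith
  · rw [abs_of_pos (sub_pos.mpr hxb), abs_of_pos (sub_pos.mpr (hab.trans hxb))] at h; linarith

/-- Closer to the larger of `a < b` ⇒ at least their midpoint. [folklore] -/
theorem add_le_two_mul_of_abs_le {x a b : ℝ} (hab : a < b) (h : |x - b| ≤ |x - a|) :
    a + b ≤ 2 * x := by
  rcases le_or_gt a x with hax | hax
  · rw [abs_of_nonneg (sub_nonneg.mpr hax)] at h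
    have := (abs_le.mp h).1; linarith
  · rw [abs_of_neg (sub_neg.mpr hax), abs_of_neg (sub_neg.mpr (hax.trans hab))] at h; linarith

/-- NO TIE ACROSS A CELL: if a real `s` and a rational `x` lie in the same open half-quantum cell
`(k ν, (k+1) ν)` of `φ`, every value of `φ` other than `fl_φ x` is STRICTLY farther from `s` than
`fl_φ x` — values and midpoints of two values are multiples of `ν`. [this packet] -/
theorem abs_sub_lt_of_sameCell {k : ℕ} {s : ℝ} {x : ℚ}
    (hs : (k : ℝ) * ((φ.quantum : ℝ) / 2) < s) (hs' : s < ((k : ℝ) + 1) * ((φ.quantum : ℝ) / 2))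
    (hx : (k : ℚ) * (φ.quantum / 2) < x) (hx' : x < ((k : ℚ) + 1) * (φ.quantum / 2))
    {y : MiniFloat φ} (hy : y.toRat ≠ (roundNE φ x).toRat) :
    |s - ((roundNE φ x).toRat : ℝ)| < |s - (y.toRat : ℝ)| := by
  obtain ⟨r, hr⟩ : ∃ r : MiniFloat φ, roundNE φ x = r := ⟨_, rfl⟩
  rw [hr] at hy ⊢
  have hq : (0 : ℝ) < φ.quantum := by exact_mod_cast φ.quantum_pos
  obtain ⟨n, hn⟩ : ∃ n : ℤ, r.toInt + y.toInt = n := ⟨_, rfl⟩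
  have hsum : r.toRat + y.toRat = (n : ℚ) * φ.quantum := by
    rw [toRat_eq_toInt_mul, toRat_eq_toInt_mul, ← hn]; push_cast; ring
  have hsumR : (r.toRat : ℝ) + (y.toRat : ℝ) = (n : ℝ) * (φ.quantum : ℝ) := by exact_mod_cast hsum
  have hnear : |(x : ℝ) - r.toRat| ≤ |(x : ℝ) - y.toRat| := by
    have := roundNE_nearest x y; rw [hr] at this; exact_mod_cast this
  have hxR : (k : ℝ) * ((φ.quantum : ℝ) / 2) < x := by exact_mod_cast hx
  have hxR' : (x : ℝ) < ((k : ℝ) + 1) * ((φ.quantum : ℝ) / 2) := by exact_mod_cast hx'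
  -- no multiple of `ν` lies in the open cell
  have key : ¬ ((k : ℝ) * ((φ.quantum : ℝ) / 2) < (n : ℝ) * ((φ.quantum : ℝ) / 2) ∧
      (n : ℝ) * ((φ.quantum : ℝ) / 2) < ((k : ℝ) + 1) * ((φ.quantum : ℝ) / 2)) := by
    rintro ⟨h1, h2⟩
    have h1' : (k : ℝ) < n := lt_of_mul_lt_mul_right h1 (by positivity)
    have h2' : (n : ℝ) < k + 1 := lt_of_mul_lt_mul_right h2 (by positivity)
    have h1'' : (k : ℤ) < n := by exact_mod_cast h1'
    have h2'' : n < (k : ℤ) + 1 := by exact_mod_cast h2'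
    omega
  by_contra hcon
  rw [not_lt] at hcon
  have hyr : (y.toRat : ℝ) ≠ r.toRat := by exact_mod_cast hy
  rcases lt_or_gt_of_ne hyr with hlt | hlt
  · -- `y < r`: `x` is at least the midpoint `n ν`, `s` at most
    have h1 := add_le_two_mul_of_abs_le hlt hnear
    have h2 := two_mul_le_add_of_abs_le hlt hcon
    exact key ⟨by linarith, by linarith⟩
  · -- `r < y`: `x` is at most the midpoint, `s` at least
    have h1 := two_mul_le_add_of_abs_le hlt hnear
    have h2 := add_le_two_mul_of_abs_le hlt hcon
    exact key ⟨by linarith, by linarith⟩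

/-- A real in an open half-quantum cell has the nearest value `fl_φ x` of any rational `x` of that
cell. [this packet] -/
theorem abs_sub_le_of_sameCell {k : ℕ} {s : ℝ} {x : ℚ}
    (hs : (k : ℝ) * ((φ.quantum : ℝ) / 2) < s) (hs' : s < ((k : ℝ) + 1) * ((φ.quantum : ℝ) / 2))
    (hx : (k : ℚ) * (φ.quantum / 2) < x) (hx' : x < ((k : ℚ) + 1) * (φ.quantum / 2))
    (y : MiniFloat φ) : |s - ((roundNE φ x).toRat : ℝ)| ≤ |s - (y.toRat : ℝ)| := by
  by_cases hy : y.toRat = (roundNE φ x).toRat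
  · rw [hy]
  · exact (abs_sub_lt_of_sameCell hs hs' hx hx' hy).le

/-- `roundNE φ` IS CONSTANT ON OPEN HALF-QUANTUM CELLS (as a value). [this packet] -/
theorem toRat_roundNE_eq_of_sameCell {k : ℕ} {x₁ x₂ : ℚ}
    (h₁ : (k : ℚ) * (φ.quantum / 2) < x₁) (h₁' : x₁ < ((k : ℚ) + 1) * (φ.quantum / 2))
    (h₂ : (k : ℚ) * (φ.quantum / 2) < x₂) (h₂' : x₂ < ((k : ℚ) + 1) * (φ.quantum / 2)) :
    (roundNE φ x₁).toRat = (roundNE φ x₂).toRat := by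
  by_contra hne
  have hlt := abs_sub_lt_of_sameCell (φ := φ) (k := k) (s := (x₂ : ℝ)) (x := x₁)
    (by exact_mod_cast h₂) (by exact_mod_cast h₂') h₁ h₁' (y := roundNE φ x₂) (Ne.symm hne)
  have hle : |(x₂ : ℝ) - (roundNE φ x₂).toRat| ≤ |(x₂ : ℝ) - (roundNE φ x₁).toRat| := by
    exact_mod_cast roundNE_nearest x₂ (roundNE φ x₁)
  exact absurd hlt (not_lt.mpr hle)

/-! ## §3 Correct rounding of the real square root -/

/-- CORRECTLY ROUNDED SQUARE ROOT: `roundNESqrt φ c` is a nearest value of `φ` to `Real.sqrt c`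
(`c ≥ 0`). [this packet; cite: IEEE7542019, §5.4.1] -/
theorem roundNESqrt_nearest {c : ℚ} (hc : 0 ≤ c) (y : MiniFloat φ) :
    |Real.sqrt c - ((roundNESqrt φ c).toRat : ℝ)| ≤ |Real.sqrt c - (y.toRat : ℝ)| := by
  have hq : (0 : ℝ) < φ.quantum := by exact_mod_cast φ.quantum_pos
  have hν : 0 < φ.quantum / 2 := by have := φ.quantum_pos; positivity
  by_cases hex : ((sqrtCell φ c : ℚ) * (φ.quantum / 2)) ^ 2 = c
  · have hs : Real.sqrt c = (sqrtSurr φ c : ℝ) := by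
      have e : (c : ℝ) = (((sqrtCell φ c : ℚ) * (φ.quantum / 2) : ℚ) : ℝ) ^ 2 := by
        exact_mod_cast hex.symm
      rw [sqrtSurr_of_sq_eq hex, e, Real.sqrt_sq (by push_cast; positivity)]
    rw [hs, roundNESqrt]; exact_mod_cast roundNE_nearest (sqrtSurr φ c) y
  · have hlt : ((sqrtCell φ c : ℚ) * (φ.quantum / 2)) ^ 2 < c := (sqrtCell_sq_le hc).lt_of_ne hex
    have h1 : (sqrtCell φ c : ℝ) * ((φ.quantum : ℝ) / 2) < Real.sqrt c := by
      rw [Real.lt_sqrt (by positivity)]; exact_mod_cast hlt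
    have h2 : Real.sqrt c < ((sqrtCell φ c : ℝ) + 1) * ((φ.quantum : ℝ) / 2) := by
      rw [Real.sqrt_lt' (by positivity)]; exact_mod_cast lt_sqrtCell_succ_sq (φ := φ) c
    rw [roundNESqrt, sqrtSurr_of_sq_ne hex]
    exact abs_sub_le_of_sameCell h1 h2 (by nlinarith) (by nlinarith) y

/-- … and it is THE nearest value (every other value is strictly farther) unless `c` is the square
of a multiple of the half quantum, in which case the surrogate IS the root and `roundNESqrt φ c` is
`roundNE φ (√c)` verbatim (ties to even). [this packet; cite: IEEE7542019, §4.3.1] -/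
theorem roundNESqrt_spec {c : ℚ} (hc : 0 ≤ c) :
    Real.sqrt c = (sqrtSurr φ c : ℝ) ∨
    ∀ y : MiniFloat φ, y.toRat ≠ (roundNESqrt φ c).toRat →
      |Real.sqrt c - ((roundNESqrt φ c).toRat : ℝ)| < |Real.sqrt c - (y.toRat : ℝ)| := by
  have hq : (0 : ℝ) < φ.quantum := by exact_mod_cast φ.quantum_pos
  have hν : 0 < φ.quantum / 2 := by have := φ.quantum_pos; positivity
  by_cases hex : ((sqrtCell φ c : ℚ) * (φ.quantum / 2)) ^ 2 = c
  · left
    have e : (c : ℝ) = (((sqrtCell φ c : ℚ) * (φ.quantum / 2) : ℚ) : ℝ) ^ 2 := by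
      exact_mod_cast hex.symm
    rw [sqrtSurr_of_sq_eq hex, e, Real.sqrt_sq (by push_cast; positivity)]
  · right
    intro y hy
    have hlt : ((sqrtCell φ c : ℚ) * (φ.quantum / 2)) ^ 2 < c := (sqrtCell_sq_le hc).lt_of_ne hex
    have h1 : (sqrtCell φ c : ℝ) * ((φ.quantum : ℝ) / 2) < Real.sqrt c := by
      rw [Real.lt_sqrt (by positivity)]; exact_mod_cast hlt
    have h2 : Real.sqrt c < ((sqrtCell φ c : ℝ) + 1) * ((φ.quantum : ℝ) / 2) := by
      rw [Real.sqrt_lt' (by positivity)]; exact_mod_cast lt_sqrtCell_succ_sq (φ := φ) c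
    rw [roundNESqrt, sqrtSurr_of_sq_ne hex] at hy ⊢
    exact abs_sub_lt_of_sameCell h1 h2 (by nlinarith) (by nlinarith) hy

/-- A square `r²` of a rational `r ≥ 0` on the half-quantum grid:
`roundNESqrt φ (r²) = roundNE φ r`. [folklore] -/
theorem roundNESqrt_sq_of_grid {K : ℕ} :
    roundNESqrt φ (((K : ℚ) * (φ.quantum / 2)) ^ 2) = roundNE φ ((K : ℚ) * (φ.quantum / 2)) := by
  have hν : 0 < φ.quantum / 2 := by have := φ.quantum_pos; positivity
  have hK : sqrtCell φ (((K : ℚ) * (φ.quantum / 2)) ^ 2) = K := by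
    refine le_antisymm ?_ (le_sqrtCell_of_sq_le le_rfl)
    have h1 := sqrtCell_sq_le (φ := φ) (c := ((K : ℚ) * (φ.quantum / 2)) ^ 2) (by positivity)
    have h2 : (sqrtCell φ (((K : ℚ) * (φ.quantum / 2)) ^ 2) : ℚ) * (φ.quantum / 2)
        ≤ (K : ℚ) * (φ.quantum / 2) :=
      le_of_pow_le_pow_left₀ two_ne_zero (by positivity) h1
    exact_mod_cast le_of_mul_le_mul_right h2 hν
  have hex : ((sqrtCell φ (((K : ℚ) * (φ.quantum / 2)) ^ 2) : ℚ) * (φ.quantum / 2)) ^ 2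
      = ((K : ℚ) * (φ.quantum / 2)) ^ 2 := by rw [hK]
  rw [roundNESqrt, sqrtSurr_of_sq_eq hex, hK]

/-! ## §4 Transfer: a finer surrogate serves a coarser grid -/

/-- TRANSFER. If `quantum ψ ∣ quantum φ` then `fl_φ` of the `ψ`-surrogate of `√c` is `fl_φ (√c)`:
both surrogates lie in the same open half-quantum cell of `φ` (or coincide with the root).
[this packet] -/
theorem toRat_roundNE_sqrtSurr {φ ψ : Format} (hq : ψ.qexp ≤ φ.qexp) {c : ℚ} (hc : 0 ≤ c) :
    (roundNE φ (sqrtSurr ψ c)).toRat = (roundNESqrt φ c).toRat := by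
  have hQ := ψ.quantum_pos; have hQφ := φ.quantum_pos
  obtain ⟨D, hDq⟩ : ∃ D : ℕ, φ.quantum = 2 ^ D * ψ.quantum := ⟨_, quantum_eq_two_pow_mul hq⟩
  have hνX : φ.quantum / 2 = 2 ^ D * (ψ.quantum / 2) := by rw [hDq]; ring
  have hν : 0 < ψ.quantum / 2 := by positivity
  have hDν : (0:ℚ) < 2 ^ D * (ψ.quantum / 2) := by positivity
  obtain ⟨hX, hXdef⟩ : ∃ hX : ℕ, sqrtCell φ c = hX := ⟨_, rfl⟩
  obtain ⟨hY, hYdef⟩ : ∃ hY : ℕ, sqrtCell ψ c = hY := ⟨_, rfl⟩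
  have loX : ((hX : ℚ) * (2 ^ D * (ψ.quantum / 2))) ^ 2 ≤ c := by
    rw [← hνX, ← hXdef]; exact sqrtCell_sq_le hc
  have hiX : c < (((hX : ℚ) + 1) * (2 ^ D * (ψ.quantum / 2))) ^ 2 := by
    rw [← hνX, ← hXdef]; exact lt_sqrtCell_succ_sq c
  have loY : ((hY : ℚ) * (ψ.quantum / 2)) ^ 2 ≤ c := by rw [← hYdef]; exact sqrtCell_sq_le hc
  have hiY : c < (((hY : ℚ) + 1) * (ψ.quantum / 2)) ^ 2 := by
    rw [← hYdef]; exact lt_sqrtCell_succ_sq c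
  -- the `ψ`-cell of the root refines its `φ`-cell: `2^D hX ≤ hY < 2^D (hX + 1)`
  have c1 : 2 ^ D * hX ≤ hY := by
    rw [← hYdef]; apply le_sqrtCell_of_sq_le
    have e : ((2 ^ D * hX : ℕ) : ℚ) * (ψ.quantum / 2) = (hX : ℚ) * (2 ^ D * (ψ.quantum / 2)) := by
      push_cast; ring
    rw [e]; exact loX
  have c2 : hY + 1 ≤ 2 ^ D * (hX + 1) := by
    by_contra hlt
    have hle : ((2 ^ D * (hX + 1) : ℕ) : ℚ) ≤ hY := by exact_mod_cast (show _ ≤ hY by omega)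
    push_cast at hle
    have h1 : ((hX : ℚ) + 1) * (2 ^ D * (ψ.quantum / 2)) ≤ (hY : ℚ) * (ψ.quantum / 2) :=
      calc ((hX : ℚ) + 1) * (2 ^ D * (ψ.quantum / 2))
            = 2 ^ D * ((hX : ℚ) + 1) * (ψ.quantum / 2) := by ring
        _ ≤ (hY : ℚ) * (ψ.quantum / 2) := mul_le_mul_of_nonneg_right hle hν.le
    have h2 := pow_le_pow_left₀ (by positivity) h1 2
    linarith
  have c1q : (2:ℚ) ^ D * hX ≤ hY := by exact_mod_cast c1
  have c2q : (hY : ℚ) + 1 ≤ 2 ^ D * ((hX : ℚ) + 1) := by exact_mod_cast c2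
  by_cases exY : ((hY : ℚ) * (ψ.quantum / 2)) ^ 2 = c
  · have hxY : ((sqrtCell ψ c : ℚ) * (ψ.quantum / 2)) ^ 2 = c := by rw [hYdef]; exact exY
    rw [sqrtSurr_of_sq_eq hxY, hYdef, roundNESqrt]
    by_cases exX : ((hX : ℚ) * (2 ^ D * (ψ.quantum / 2))) ^ 2 = c
    · -- both surrogates are the root
      have hxX : ((sqrtCell φ c : ℚ) * (φ.quantum / 2)) ^ 2 = c := by rw [hXdef, hνX]; exact exX
      have e : (hX : ℚ) * (2 ^ D * (ψ.quantum / 2)) = hY * (ψ.quantum / 2) :=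
        (pow_left_inj₀ (by positivity) (by positivity) two_ne_zero).mp (exX.trans exY.symm)
      rw [sqrtSurr_of_sq_eq hxX, hXdef, hνX, e]
    · -- the root `hY ν` is off the `φ`-grid: it lies in the open `φ`-cell `hX`
      have hxX : ((sqrtCell φ c : ℚ) * (φ.quantum / 2)) ^ 2 ≠ c := by rw [hXdef, hνX]; exact exX
      rw [sqrtSurr_of_sq_ne hxX, hXdef, hνX]
      have lo : (hX : ℚ) * (2 ^ D * (ψ.quantum / 2)) < hY * (ψ.quantum / 2) := by
        refine lt_of_le_of_ne ?_ (fun h => exX (by rw [h]; exact exY))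
        exact le_of_pow_le_pow_left₀ two_ne_zero (by positivity) (by rw [exY]; exact loX)
      have hi : (hY : ℚ) * (ψ.quantum / 2) < ((hX : ℚ) + 1) * (2 ^ D * (ψ.quantum / 2)) :=
        lt_of_pow_lt_pow_left₀ 2 (by positivity) (by rw [exY]; exact hiX)
      exact toRat_roundNE_eq_of_sameCell (k := hX) (by rw [hνX]; exact lo) (by rw [hνX]; exact hi)
        (by rw [hνX]; nlinarith) (by rw [hνX]; nlinarith)
  · -- inexact in `ψ`, hence in `φ`: both midpoints lie in the open `φ`-cell `hX`
    have hxY : ((sqrtCell ψ c : ℚ) * (ψ.quantum / 2)) ^ 2 ≠ c := by rw [hYdef]; exact exY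
    have exX : ((hX : ℚ) * (2 ^ D * (ψ.quantum / 2))) ^ 2 ≠ c := by
      intro h
      have h' : (((2 ^ D * hX : ℕ) : ℚ) * (ψ.quantum / 2)) ^ 2 = c := by
        rw [← h]; push_cast; ring
      have hle : hY ≤ 2 ^ D * hX := by
        have h3 : ((hY : ℚ) * (ψ.quantum / 2)) ^ 2
            ≤ (((2 ^ D * hX : ℕ) : ℚ) * (ψ.quantum / 2)) ^ 2 := by rw [h']; exact loY
        have h4 := le_of_pow_le_pow_left₀ two_ne_zero (by positivity) h3
        exact_mod_cast le_of_mul_le_mul_right h4 hν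
      have heq : hY = 2 ^ D * hX := le_antisymm hle c1
      apply exY; rw [heq]; exact h'
    have hxX : ((sqrtCell φ c : ℚ) * (φ.quantum / 2)) ^ 2 ≠ c := by rw [hXdef, hνX]; exact exX
    rw [sqrtSurr_of_sq_ne hxY, hYdef, roundNESqrt, sqrtSurr_of_sq_ne hxX, hXdef, hνX]
    exact toRat_roundNE_eq_of_sameCell (k := hX) (by rw [hνX]; nlinarith) (by rw [hνX]; nlinarith)
      (by rw [hνX]; nlinarith) (by rw [hνX]; nlinarith)

/-! ## §5 Double rounding of square roots: the property, its test, its tables -/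

/-- `DRSqrt φ ψ`: for every value `a ≥ 0` of `φ`, `fl_φ (fl_ψ (√a)) = fl_φ (√a)` — ONE square root
executed (correctly rounded, `roundNESqrt`) in `ψ` and converted to `φ` is the correctly rounded
square root of `φ` (saturating RNE, subnormals kept). [this packet; cite: Roux2014, Thm 25] -/
def DRSqrt (φ ψ : Format) : Prop :=
  ∀ a : MiniFloat φ, 0 ≤ a.toRat →
    (roundNE φ (roundNESqrt ψ a.toRat).toRat).toRat = (roundNESqrt φ a.toRat).toRat

/-- `DRSqrt` BY EXHAUSTION of the source format, as one boolean for the kernel. [this packet] -/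
def drSqrtExh (φ ψ : Format) : Bool :=
  (all φ).all fun a => !decide (0 ≤ a.toRat) ||
    decide ((roundNE φ (roundNESqrt ψ a.toRat).toRat).toRat = (roundNESqrt φ a.toRat).toRat)

/-- Soundness of the exhaustion. [folklore] -/
theorem drSqrt_of_exh {φ ψ : Format} (h : drSqrtExh φ ψ = true) : DRSqrt φ ψ := fun a ha => by
  have := forall_of_all_all h a
  simp only [Bool.or_eq_true, Bool.not_eq_true', decide_eq_false_iff_not, decide_eq_true_eq]
    at this
  exact this.resolve_left fun hn => hn ha

/-- (I): `DRSqrt φ φ`. [folklore] -/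
theorem drSqrt_self (φ : Format) : DRSqrt φ φ := fun _ _ => toRat_roundNE_toRat _

/-- (G): same grid with a larger top. [this packet] -/
theorem drSqrt_of_sameGrid {φ ψ : Format} (hm : ψ.manBits = φ.manBits)
    (he : ψ.emaxCode = φ.emaxCode) (hb : ψ.bias = φ.bias) (hM : φ.maxScaled ≤ ψ.maxScaled) :
    DRSqrt φ ψ := fun a ha => by
  have hq : ψ.qexp ≤ φ.qexp := by unfold Format.qexp; omega
  unfold roundNESqrt
  rw [toRat_roundNE_roundNE_of_sameGrid hm he hb hM, toRat_roundNE_sqrtSurr hq ha, roundNESqrt]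

/-- Witness replay: a rational `r ≥ 0` pushed through `fl_φ` is an operand `≥ 0`; if the two routes
differ on it, `DRSqrt φ ψ` fails. [folklore] -/
theorem not_drSqrt_of_ne {φ ψ : Format} (r : ℚ) (hr : 0 ≤ r)
    (h : (roundNE φ (roundNESqrt ψ (roundNE φ r).toRat).toRat).toRat
      ≠ (roundNESqrt φ (roundNE φ r).toRat).toRat) : ¬ DRSqrt φ ψ := fun hall => by
  have h0 : 0 ≤ (roundNE φ r).toRat := by
    have := toRat_roundNE_mono (φ := φ) hr; rwa [toRat_roundNE_zero] at this
  exact h (hall _ h0)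

/-! ## §6 Kernel instances -/

/-- `fl_binary16 (√(31/128)) = 63/128` while `fl_binary8p5 (√(31/128)) = 31/64` and
`fl_binary8p5 (63/128) = 1/2`: the binary8p5 → binary16 cell of the matrix fails; `√4 = 2`
exactly; `fl_e2m1 (√3) = 3/2`. -/
example : (roundNESqrt Binary16 (31 / 128)).toRat = 63 / 128 ∧
    (roundNESqrt Binary8p5 (31 / 128)).toRat = 31 / 64 ∧
    (roundNE Binary8p5 (63 / 128 : ℚ)).toRat = 1 / 2 ∧ (roundNESqrt Binary32 4).toRat = 2 ∧
    (roundNESqrt E2M1 3).toRat = 3 / 2 := by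
  refine ⟨?_, ?_, ?_, ?_, ?_⟩ <;> decide +kernel

end Summit.Ventures.CertifiedArithmetic
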